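import Literature.MathematicalPhysics.KineticTheory.BathExchangeDynamics
import HarnessLib

/-!
# Hard-sphere flow with a conservative Ornstein–Uhlenbeck-type velocity exchange

Topic `Literature/MathematicalPhysics/KineticTheory` (definition item `defn-OUExchangeHardSphereDynamics`,
wanted by the crux `BathReduction` of route `AtomisticToContinuum/EinsteinBathSolvent`
(`stmt-AtomisticToContinuum-12832`), "shared in spirit" with the noisy dynamics of route
`VanishingNoise`).

**The object.** `N` hard spheres of diameter `ε` in a geometry `G` (the case of interest is
`N + 1` spheres on the flat torus, `G = Torus.geometry (Fin 3)`, phase space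
`Config (N + 1) (Fin 3) (UnitAddTorus (Fin 3))`) perform the deterministic hard-sphere motion —
free flight and specular elastic collisions, as in `Literature.Analysis.FluidPDE.HardSphereFlow` —
and, in addition, the velocities of every pair `(i, j)` within a microscopic range `r` undergo,
with intensity `γ ≥ 0`, a *conservative* diffusive exchange of momentum and kinetic energy: the
pair velocity `(v_i, v_j)` diffuses on its conservation fibre `{v_i + v_j = const,
|v_i|² + |v_j|² = const}` (for `d = 3` a `2`-sphere in the relative velocity), reversibly with
respect to Lebesgue measure — hence with respect to every product of Maxwellians, which is
constant on the fibres. This is the stochastic perturbation of Olla–Varadhan–Yau 1993 §1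
(p. 525: "They exchange velocities randomly and continuously but in such a way as to conserve the
combined momenta and energy of the pair of particles") and §2.1 ((2.4) the four conservation laws,
(2.5) `L_{1,2} = γ(c_{1,2}) Δ_{Γ_{c_{1,2}}}` the Laplace–Beltrami operator of the conservation
surface — "We can choose in fact a more general operator `L_{12}`, as long as it is elliptic of
second order acting only on tangential directions of `Γ_c`. We note that the operator `L_{12}` is
clearly selfadjoint with respect to Lebesgue measure on `ℝ⁶`" — and (2.6) the noisy generator
`L_{ε,θ} = L_ε + θ(ε) ∑_{α≠β} ψ(ε, x_α - x_β) L_{α,β}`), of Liverani–Olla 1996 §1 pp. 405–406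
(vector fields `X(σ) = ⟨σ, ∂_{p_α} - ∂_{p_β}⟩` with null divergence and tangent to the
conservation surfaces (1.3)–(1.4), `X(σ)^* = -X(σ)`, `L̂_{α,β} = ½ ∑_κ X(σ_κ)²`, range cutoff
`χ(q_α - q_β)` with `χ > 0` exactly for `‖q‖ < R₁`), described by Fritz–Funaki–Lebowitz 1994 §1.1
(p. 212) as "a diffusive noise mimicking 'randomizing collisions' between pairs of particles. This
noise conserves momentum and energy, but otherwise uniformly spreads the relative momenta" — here
superposed on the *collisional* hard-sphere dynamics (the planners' "Ornstein–Uhlenbeck-type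
exchange": a velocity diffusion reversible for the Maxwellians; `γ = 0` is the bare hard-sphere
flow in law).

**What is new relative to `BathExchangeDynamics`.** Nothing is redefined: the general noisy
hard-sphere dynamics with an arbitrary pair operator `K`, rate profile `ψ`, scale `r` and
strength `γ` is the hypothesis structure `Literature.MathematicalPhysics.KineticTheory.BathExchangeDynamics`
(path-space laws `P_z` on the canonical space `Traj G ε N`, Liouville-conull `good` set of data,
start / simple Markov property / martingale problem "Liouville (pathwise) + `noiseGenerator`").
This file supplies the two things the item asks for on top of it:

* `ouExchange q` — the **OU / divergence-form exchange operator with a smooth scalar kernel**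
  `q(n, v, w)` (`n = x_i - x_j` the separation vector):
  `S^q_n f = ½ ∑_{k,l} X(σ_{kl}) (q(n, ·) · X(σ_{kl}) f)`, where `σ_{kl}` are the rotation fields
  of the relative velocity (`rotationField`, tangent and divergence free) and `X(σ) = pairField σ`.
  For every `q` it is in divergence form along the fibre, so it is symmetric w.r.t. Lebesgue
  measure on `ℝ^d × ℝ^d` (`X(σ)^* = -X(σ)`), acts along the conservation fibres only (exact
  conservation of `v + w`, `|v|² + |w|²`) and kills constants; for `q ≥ 0` it is dissipative, and
  for a kernel depending on the pair invariants only it is OVY's `γ(c) Δ_{Γ_c}` up to the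
  identification of `½ ∑ X(σ_{kl})²` with a multiple of the fibre Laplacian (`ovyExchange`). The
  general `q(n, v, w)` is OVY's "more general operator" in symmetric form with scalar diffusivity
  (the configuration-dependent Epstein/ping-pong kernel of route EinsteinBathSolvent is of this
  kind). `-- TODO(general form): tensor-valued diffusivity ∑_{κ,κ'} X(σ_κ)(a_{κκ'} X(σ_{κ'}) f)`.
* `OUExchangeHardSphereDynamics G ε N q ψ r γ` — the dynamics: it `extends`
  `BathExchangeDynamics G ε N (ouExchange q) ψ r γ` by ONE further property the genuine object has,
  **invariance of the Liouville measure** `liouville G N ε` (Lebesgue measure restricted to the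
  hard-sphere domain — the reference measure of every local Gibbs law,
  `Literature.Analysis.FluidPDE.particleLaw` / `localGibbsLaw`): `∫ P_z(ω_t ∈ A) dz = |A ∩ D_ε^N|`.
  This is the counterpart of the field `HardSphereFlow.measurePreserving` of the deterministic
  flow (free flight and elastic collisions preserve Liouville measure; the exchange is symmetric
  w.r.t. Lebesgue measure on the velocities at frozen positions, OVY 1993 §2.1), requested by the
  item ("preservation of every local Gibbs law's reference measure"). Derived API: `kernel`,
  `lawAt`, `pathLaw` (inherited), `isInvariant_liouville`, `lawAt_liouville`, the unit-strength
  exchange generator `ouGenerator` with the decomposition "generator = Liouville (pathwise) +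
  `γ • ouGenerator`" (`noiseGenerator_ouExchange`), and the range profile `unitBallProfile`
  realising "pairs at distance `< r`" sharply (`unitBallProfile_smul`).

**Instantiation for the route.** `N + 1` spheres of diameter `ε_N = hsDiameter σ N` on `𝕋³` with
kernel `q`, range `r` (e.g. the light mean free path) and intensity `γ_N`:
`OUExchangeHardSphereDynamics (Torus.geometry (Fin 3)) (hsDiameter σ N) (N + 1) q ψ r γ_N` with
`ψ = unitBallProfile` (sharp range `r`) or a smooth radial bump positive exactly on the open unit
ball (Liverani–Olla's `χ`); its field `law` is a Markov kernel from
`Config (N + 1) (Fin 3) (UnitAddTorus (Fin 3))` to path space and `kernel t` the transition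
semigroup on that phase space.

## Design notes

* EXISTENCE IS NOT A FIELD AND NOT ASSERTED. As for `HardSphereFlow` (whose existence is the
  separate statement `HardSphereFlow.nonempty_torus`) and `BathExchangeDynamics`, the structure
  lists properties the process HAS; "existence for Lebesgue-a.e. data" is rendered, exactly as for
  the deterministic flow, by the Liouville-conull `good` set on which the laws are pinned down,
  while `Nonempty (OUExchangeHardSphereDynamics …)` (well-posedness of the martingale problem with
  collisions, a.s. local finiteness of collisions under the noise) is a construction statement for
  the route to carry — no source proves it for hard cores (OVY and LO work with smooth
  superstable potentials and LO explicitly "are not concerned with the existence of the dynamics",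
  §1 p. 405), so it is neither a Literature fact nor smuggled in here.
* WHY A NEW STRUCTURE RATHER THAN AN ABBREVIATION. Liouville invariance is a theorem about the
  genuine process but does not follow from the fields of `BathExchangeDynamics` (which constrain
  `law` only through the velocity martingale problem and do not encode uniqueness in law); the item
  wants it available to consumers, so it is a field, in the integrated form
  `∫⁻ z, law z {ω | ω t ∈ A} ∂liouville = liouville A` that mentions only the primitive field `law`
  (`isInvariant_liouville` converts it to `μ ≫= kernel t = μ`).
* `q` MAY DEPEND ON THE SEPARATION VECTOR (configuration-dependent diffusivity, as the bath-mediated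
  kernel of the route); OVY's `γ(c)` depends on the invariants only, LO's fields not at all.
  Smoothness / nonnegativity of `q` are NOT built into the type (they are hypotheses of theorems
  about `ouExchange q`, e.g. dissipativity needs `0 ≤ q`).
* RANGE. OVY's `ψ(ε, ·)` is smooth and positive everywhere (2.7), LO's `χ` is smooth, radial,
  positive exactly on `‖q‖ < R₁`; the item's "pairs at distance `< r`" is either of
  `ψ = unitBallProfile` (sharp) or such a bump, scaled by `r` inside `noiseGenerator`
  (`ψ (r⁻¹ • n)`); the profile therefore stays a parameter, as in the parent structure.
* Everything else (path space `Traj`, filtration, `noiseMartingale`, Markov property, the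
  `t = 0` exemption of the collision rule, `law` outside `good`) is inherited verbatim; see the
  design notes of `BathExchangeDynamics`.

## References

* S. Olla, S. R. S. Varadhan, H.-T. Yau, *Hydrodynamical limit for a Hamiltonian system with weak
  noise*, Comm. Math. Phys. 155 (1993) 523–560, §1 p. 525, §2.1 pp. 526–527 ((2.4)–(2.7)).
  [OllaVaradhanYau1993]
* C. Liverani, S. Olla, *Ergodicity in infinite Hamiltonian systems with conservative noise*,
  Probab. Theory Relat. Fields 106 (1996) 401–445, §1 pp. 405–407 ((1.3)–(1.5)). [LiveraniOlla1996]
* J. Fritz, T. Funaki, J. L. Lebowitz, *Stationary states of random Hamiltonian systems*, Probab.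
  Theory Relat. Fields 99 (1994) 211–236, §1.1 p. 212. [FritzFunakiLebowitz1994]
-/

noncomputable section

open MeasureTheory ProbabilityTheory Filter Set Function
open scoped NNReal ENNReal InnerProductSpace

namespace Literature.MathematicalPhysics.KineticTheory

open Literature.Analysis.FluidPDE

variable {d : Type*} [Fintype d]

/-! ### Range profile -/

/-- The **sharp range profile**: the indicator of the open unit ball of `ℝ^d`, so that the rate
`ψ (r⁻¹ • n)` entering `noiseGenerator` is `1` exactly for pairs at (minimal-image) distance
`‖n‖ < r` and `0` otherwise (`unitBallProfile_smul`); Liverani–Olla's smooth radial `χ`, positive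
exactly on `‖q‖ < R₁` (1996 §1 p. 406), is the regularised alternative. [folklore] -/
def unitBallProfile (n : EuclideanSpace ℝ d) : ℝ :=
  if ‖n‖ < 1 then 1 else 0

/-- Unfolding lemma for `unitBallProfile`. [folklore] -/
theorem unitBallProfile_apply (n : EuclideanSpace ℝ d) :
    unitBallProfile n = if ‖n‖ < 1 then 1 else 0 := rfl

/-- Scaled by `r > 0`, the sharp profile detects exactly the pairs at distance `< r`. [folklore] -/
theorem unitBallProfile_smul {r : ℝ} (hr : 0 < r) (n : EuclideanSpace ℝ d) :
    unitBallProfile (r⁻¹ • n) = if ‖n‖ < r then 1 else 0 := by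
  have h : ‖r⁻¹ • n‖ < 1 ↔ ‖n‖ < r := by
    rw [norm_smul, norm_inv, Real.norm_of_nonneg hr.le, inv_mul_lt_iff₀ hr, mul_one]
  simp only [unitBallProfile, h]

/-- The sharp profile takes values in `{0, 1}`, in particular it is nonnegative. [folklore] -/
theorem unitBallProfile_nonneg (n : EuclideanSpace ℝ d) : 0 ≤ unitBallProfile n := by
  unfold unitBallProfile
  split_ifs <;> norm_num

/-! ### The OU (divergence-form) pair exchange operator with a smooth kernel -/

section OU

variable [DecidableEq d]

/-- The **Ornstein–Uhlenbeck-type (divergence-form) exchange operator with kernel `q`**: for a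
separation vector `n` and a function `f` of the pair velocities,
`S^q_n f = ½ ∑_{k,l} X(σ_{kl}) (q(n, ·) · X(σ_{kl}) f)`, where `σ_{kl}(v, w) = u_k e_l - u_l e_k`
(`u = v - w`) are the rotation fields of the relative velocity and `X(σ) f = Df · (σ, -σ)`
(`pairField`). A second-order operator acting only in the tangential directions of the
conservation surfaces `Γ_c = {v + w = c', |v|² + |w|² = c₄}`, symmetric with respect to Lebesgue
measure on `ℝ^d × ℝ^d` for every `q` because the fields are tangent and divergence free
(`X(σ)^* = -X(σ)`, LO 1996 §1 p. 406) — OVY's admissible class "elliptic of second order acting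
only on tangential directions of `Γ_c` … selfadjoint with respect to Lebesgue measure on `ℝ⁶`"
(1993 §2.1, after (2.5)), written in symmetric form with a scalar diffusivity `q(n, v, w) ≥ 0`;
for `q` a function of the invariants `c` it is `γ(c) Δ_{Γ_c}` up to normalisation ((2.5),
cf. `ovyExchange`). `fderiv` junk (`0`) where the functions are not differentiable.
[cite: OllaVaradhanYau1993, §2.1 (2.5)] -/
def ouExchange (q : EuclideanSpace ℝ d → PairVel d → ℝ) : PairExchange d :=
  fun n f p => 2⁻¹ * ∑ kl : d × d,
    pairField (rotationField kl.1 kl.2)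
      (fun p' => q n p' * pairField (rotationField kl.1 kl.2) f p') p

/-- Unfolding lemma for `ouExchange`. [folklore] -/
theorem ouExchange_apply (q : EuclideanSpace ℝ d → PairVel d → ℝ) (n : EuclideanSpace ℝ d)
    (f : PairVel d → ℝ) (p : PairVel d) :
    ouExchange q n f p = 2⁻¹ * ∑ kl : d × d,
      pairField (rotationField kl.1 kl.2)
        (fun p' => q n p' * pairField (rotationField kl.1 kl.2) f p') p := rfl

/-- The OU exchange operator kills constants (it is a Markov pregenerator). [folklore] -/
@[simp]
theorem ouExchange_const (q : EuclideanSpace ℝ d → PairVel d → ℝ) (n : EuclideanSpace ℝ d)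
    (c : ℝ) : ouExchange q n (fun _ => c) = 0 := by
  funext p
  simp [ouExchange]

/-- With the zero kernel there is no exchange. [folklore] -/
@[simp]
theorem ouExchange_zero_kernel (n : EuclideanSpace ℝ d) (f : PairVel d → ℝ) :
    ouExchange (0 : EuclideanSpace ℝ d → PairVel d → ℝ) n f = 0 := by
  funext p
  simp [ouExchange]

/-! ### The exchange part of the generator -/

section Generator

variable {X : Type*} {N : ℕ}

/-- The **symmetric exchange part `S` of the generator** at unit intensity, acting on a test
function `φ` of the velocities at positions `x`:
`S φ (v) = ∑_{i ≠ j} ψ(r⁻¹ n_{ij}) (S^q_{n_{ij}}) (p ↦ φ(v with (v_i, v_j) := p)) (v_i, v_j)`,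
`n_{ij} = G.sepVec x_i x_j` — the `noiseGenerator` of the OU kernel with `γ = 1`; the full noisy
generator is "Liouville (free flight + hard-core collisions, encoded pathwise) `+ γ S`"
(OVY 1993 (2.6) `L_ε + θ(ε) ∑_{α≠β} ψ L_{α,β}`, `noiseGenerator_ouExchange`).
[cite: OllaVaradhanYau1993, §2.1 (2.6)] -/
def ouGenerator (G : Geometry d X) (q : EuclideanSpace ℝ d → PairVel d → ℝ)
    (ψ : EuclideanSpace ℝ d → ℝ) (r : ℝ) (x : Fin N → X) (φ : (Fin N → EuclideanSpace ℝ d) → ℝ)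
    (v : Fin N → EuclideanSpace ℝ d) : ℝ :=
  noiseGenerator G (ouExchange q) ψ r 1 x φ v

/-- Unfolding lemma for `ouGenerator`. [folklore] -/
theorem ouGenerator_eq (G : Geometry d X) (q : EuclideanSpace ℝ d → PairVel d → ℝ)
    (ψ : EuclideanSpace ℝ d → ℝ) (r : ℝ) (x : Fin N → X) (φ : (Fin N → EuclideanSpace ℝ d) → ℝ)
    (v : Fin N → EuclideanSpace ℝ d) :
    ouGenerator G q ψ r x φ v = noiseGenerator G (ouExchange q) ψ r 1 x φ v := rfl

/-- **`L = A + γ S`**: the noise part of the generator of the OU exchange dynamics with intensity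
`γ` is `γ` times the unit-intensity exchange generator `S = ouGenerator` (OVY 1993 (2.6), the
factor `θ(ε)`). [cite: OllaVaradhanYau1993, §2.1 (2.6)] -/
theorem noiseGenerator_ouExchange (G : Geometry d X) (q : EuclideanSpace ℝ d → PairVel d → ℝ)
    (ψ : EuclideanSpace ℝ d → ℝ) (r γ : ℝ) (x : Fin N → X) (φ : (Fin N → EuclideanSpace ℝ d) → ℝ)
    (v : Fin N → EuclideanSpace ℝ d) :
    noiseGenerator G (ouExchange q) ψ r γ x φ v = γ * ouGenerator G q ψ r x φ v := by
  simp [ouGenerator, noiseGenerator]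

/-- The exchange generator kills constants. [folklore] -/
@[simp]
theorem ouGenerator_const (G : Geometry d X) (q : EuclideanSpace ℝ d → PairVel d → ℝ)
    (ψ : EuclideanSpace ℝ d → ℝ) (r : ℝ) (x : Fin N → X) (c : ℝ) (v : Fin N → EuclideanSpace ℝ d) :
    ouGenerator G q ψ r x (fun _ => c) v = 0 :=
  noiseGenerator_const G (fun n c' => ouExchange_const q n c') ψ r 1 x c v

/-- With the zero kernel the exchange generator vanishes (bare hard-sphere flow). [folklore] -/
@[simp]
theorem ouGenerator_zero_kernel (G : Geometry d X) (ψ : EuclideanSpace ℝ d → ℝ) (r : ℝ)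
    (x : Fin N → X) (φ : (Fin N → EuclideanSpace ℝ d) → ℝ) (v : Fin N → EuclideanSpace ℝ d) :
    ouGenerator G (0 : EuclideanSpace ℝ d → PairVel d → ℝ) ψ r x φ v = 0 := by
  simp [ouGenerator, noiseGenerator]

end Generator

/-! ### The dynamics -/

section Dynamics

variable {X : Type*} [MeasureSpace X] [TopologicalSpace X] {N : ℕ}

/-- **Hard-sphere flow with a conservative OU-type velocity exchange** (Olla–Varadhan–Yau 1993
§1, §2.1 (2.4)–(2.6); Liverani–Olla 1996 §1; Fritz–Funaki–Lebowitz 1994 §1.1): the Markov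
dynamics of `N` hard spheres of diameter `ε` in the geometry `G` — free flight and elastic
collisions — whose pairs within range `r` (profile `ψ`) exchange momentum and kinetic energy by
the OU kernel `ouExchange q` with intensity `γ ≥ 0` (`γ = 0`: the bare hard-sphere flow in law),
as a *hypothesis structure*: all the fields of
`BathExchangeDynamics G ε N (ouExchange q) ψ r γ` — the path laws `law z = P_z` on the canonical
space `Traj G ε N` (a Markov kernel), a measurable Liouville-conull `good ⊆ D_ε^N` set of initial
data (the dynamics "for Lebesgue-a.e. data"), and for `z ∈ good` the start `P_z(ω_0 = z) = 1`, the
simple Markov property and the martingale problem for the generator "Liouville `+ γ S`"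
(`noiseMartingale`, collisions compensated pathwise) — together with **invariance of the
Liouville measure** `liouville G N ε` (the reference measure of the local Gibbs laws):
`∫ P_z(ω_t ∈ A) dz = liouville A` for measurable `A`. Existence (well-posedness) is NOT a field and
is not asserted in this file. Route instance: `G = Torus.geometry (Fin 3)`, `N + 1` spheres,
`ε = hsDiameter σ N`. [cite: OllaVaradhanYau1993, §2.1 (2.4)–(2.6)] -/
structure OUExchangeHardSphereDynamics (G : Geometry d X) (ε : ℝ) (N : ℕ)
    (q : EuclideanSpace ℝ d → PairVel d → ℝ) (ψ : EuclideanSpace ℝ d → ℝ) (r γ : ℝ)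
    extends BathExchangeDynamics G ε N (ouExchange q) ψ r γ where
  /-- The Liouville measure is invariant: `∫ P_z(ω_t ∈ A) liouville(dz) = liouville A`. -/
  liouville_invariant : ∀ (t : ℝ≥0) (A : Set (Config N d X)), MeasurableSet A →
    ∫⁻ z, law z {ω | ω.1 t ∈ A} ∂(liouville G N ε) = liouville G N ε A

namespace OUExchangeHardSphereDynamics

variable {G : Geometry d X} {ε : ℝ} {q : EuclideanSpace ℝ d → PairVel d → ℝ}
  {ψ : EuclideanSpace ℝ d → ℝ} {r γ : ℝ}

/-- Each path law `P_z` is a probability measure. [folklore] -/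
instance isMarkovKernel_law (S : OUExchangeHardSphereDynamics G ε N q ψ r γ) :
    IsMarkovKernel S.law :=
  S.isMarkovKernel

/-- Liouville-almost every initial datum is good ("the dynamics exists for Lebesgue-a.e. data"
is rendered by the conull good set, as for `HardSphereFlow`). [folklore] -/
theorem ae_mem_good (S : OUExchangeHardSphereDynamics G ε N q ψ r γ) :
    ∀ᵐ z ∂liouville G N ε, z ∈ S.good :=
  S.measure_compl_good

/-- **The Liouville measure is invariant** for the OU exchange dynamics:
`liouville ≫= P_t = liouville` for every `t ≥ 0` (the structure field, in the form
`BathExchangeDynamics.IsInvariant`). [cite: OllaVaradhanYau1993, §2.1] -/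
theorem isInvariant_liouville (S : OUExchangeHardSphereDynamics G ε N q ψ r γ) :
    S.IsInvariant (liouville G N ε) := by
  intro t
  refine Measure.ext fun A hA => ?_
  have h := S.toBathExchangeDynamics.lawAt_apply (liouville G N ε) t hA
  rw [BathExchangeDynamics.lawAt_eq] at h
  rw [h, S.liouville_invariant t A hA]

/-- Under the Liouville initial measure the law at every time is the Liouville measure.
[folklore] -/
theorem lawAt_liouville (S : OUExchangeHardSphereDynamics G ε N q ψ r γ) (t : ℝ≥0) :
    S.lawAt (liouville G N ε) t = liouville G N ε :=
  S.toBathExchangeDynamics.lawAt_eq_self_of_isInvariant S.isInvariant_liouville t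

/-- The invariance field read on sets: the `liouville`-mixture of the transition probabilities
`P_t(z, A)` is `liouville A`. [folklore] -/
theorem lintegral_kernel_liouville (S : OUExchangeHardSphereDynamics G ε N q ψ r γ) (t : ℝ≥0)
    {A : Set (Config N d X)} (hA : MeasurableSet A) :
    ∫⁻ z, S.kernel t z A ∂liouville G N ε = liouville G N ε A := by
  have h := S.isInvariant_liouville t
  rw [← Measure.bind_apply hA (Kernel.aemeasurable _), h]

/-- The martingale problem of the OU exchange dynamics, with the generator in the form
`γ • S`: for `z ∈ good` and smooth compactly supported `φ` of the velocities,
`φ(v_t) - φ(v_0) - ∫₀ᵗ γ S_{x_s} φ (v_s) ds - (collision jumps)` is a `P_z`-martingale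
(the structure field `martingale`, restated through `noiseGenerator_ouExchange`).
[cite: OllaVaradhanYau1993, §2.1 (2.6)] -/
theorem martingale_ouGenerator (S : OUExchangeHardSphereDynamics G ε N q ψ r γ) {z : Config N d X}
    (hz : z ∈ S.good) (φ : (Fin N → EuclideanSpace ℝ d) → ℝ) (hφ : ContDiff ℝ (⊤ : ℕ∞) φ)
    (hφc : HasCompactSupport φ) :
    Martingale (fun (t : ℝ≥0) (ω : Traj G ε N) =>
        φ (Config.vel (ω.1 t)) - φ (Config.vel (ω.1 0)) -
          (∫ s in (0 : ℝ)..(t : ℝ), γ * ouGenerator G q ψ r (Config.pos (ω.1 s.toNNReal)) φ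
            (Config.vel (ω.1 s.toNNReal))) -
          collisionJumps G ε φ ω.1 t)
      (trajFiltration G ε N) (S.law z) := by
  have h := S.martingale z hz φ hφ hφc
  simp only [noiseMartingale, noiseGenerator_ouExchange] at h
  exact h

/-- At zero intensity the martingale problem is that of the bare hard-sphere flow:
`φ(v_t) - φ(v_0) - (collision jumps)` is a `P_z`-martingale (no compensator). [folklore] -/
theorem martingale_of_strength_zero (S : OUExchangeHardSphereDynamics G ε N q ψ r 0)
    {z : Config N d X} (hz : z ∈ S.good) (φ : (Fin N → EuclideanSpace ℝ d) → ℝ)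
    (hφ : ContDiff ℝ (⊤ : ℕ∞) φ) (hφc : HasCompactSupport φ) :
    Martingale (fun (t : ℝ≥0) (ω : Traj G ε N) =>
        φ (Config.vel (ω.1 t)) - φ (Config.vel (ω.1 0)) - collisionJumps G ε φ ω.1 t)
      (trajFiltration G ε N) (S.law z) := by
  have h := S.martingale z hz φ hφ hφc
  simp only [noiseMartingale, noiseGenerator_zero_strength, intervalIntegral.integral_zero,
    sub_zero] at h
  exact h

end OUExchangeHardSphereDynamics

end Dynamics

end OU

end Literature.MathematicalPhysics.KineticTheory
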